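import Mathlib.Algebra.Polynomial.Eval.Defs
import Mathlib.Algebra.Polynomial.Degree.Defs
import Mathlib.Data.ZMod.Defs
import Mathlib.Data.Nat.Log
import Mathlib.Data.Nat.Sqrt
import Mathlib.Data.Nat.Prime.Defs
import Mathlib.Analysis.SpecialFunctions.Pow.Real
import Mathlib.Analysis.SpecialFunctions.Log.Basic
import Mathlib.Order.Filter.AtTopBot.Defs
import Literature.Computability.Complexity.Circuit
import HarnessLib

/-!
# Cavalar–Kumar–Rossman: `exp(n^{1/2 - o(1)})` for monotone circuits (Harnik–Raz function)

Named fact (D-0014) requested by route PneNP/NegLimited, crux #4 (`wi-03884`): the strongest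
known lower bound for MONOTONE circuits computing an explicit `n`-variate monotone Boolean
function, `2^{Ω(n^{1/2} / log n)}`, obtained by Cavalar, Kumar and Rossman from the
Alweiss–Lovett–Wu–Zhang robust-sunflower bound (arXiv:2012.03883 = Algorithmica 84 (2022);
LATIN 2020), improving Harnik–Raz / Andreev `2^{Ω((n / log n)^{1/3})}`.

* `harnikRazSet n k P` — `S_P = {P(1), …, P(k)} ⊆ 𝔽_n` for a polynomial `P ∈ 𝔽_n[x]`;
* `harnikRazFn n c k` — the Harnik–Raz function `f_HR^{(c,k)} : {0,1}^{𝔽_n} → {0,1}`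
  (arXiv:2012.03883, §2.3 "The function"): `f_HR(x) = 1` iff `x ⊇ S_P` (as a set of coordinates)
  for some `P` of degree `≤ c - 1` with `|S_P| ≥ k/2`; variables are indexed by `𝔽_n = ZMod n`
  (`n` prime in the source). PROVED: `harnikRazFn_monotone`.
* Fact `cavalar_kumar_rossman` — [arXiv:2012.03883v2, Thm. 2.19 (`thm:hr_lower_bound`, §2.7
  "The lower bound")]: with `k = n^{1/2}` and `c = k / (T log n)` (`T = 18 B`, `B` the
  robust-sunflower constant), every monotone circuit computing `f_HR` has size
  `2^{Ω(c)} = 2^{Ω(n^{1/2}/log n)}`.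

## Faithfulness

* Monotone circuits are fan-in-2 `{∧, ∨}` circuits: `Circuit.IsOver monotoneBasis`.
* The source takes `n` prime and "assumes for simplicity" that `k = n^{1/2}` and `c` are
  integers; we use `k = ⌊√n⌋`, `c = ⌊√n⌋ / (T · ⌊log₂ n⌋)` (natural-number division) — the
  standard reading of that convention — and quantify the unspecified constants existentially
  (`∃ T > 0`, `∃ ε > 0`) with the conclusion for all sufficiently large primes `n`
  (`∀ᶠ n in atTop, n.Prime → …`). The base of `log` is immaterial (absorbed in `ε`, `T`).
* Only the prime-`n` statement is recorded (extension to all `n` by padding is routine but not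
  printed).

## References

* B. P. Cavalar, M. Kumar, B. Rossman, *Monotone circuit lower bounds from robust sunflowers*,
  Algorithmica 84 (2022) 3655–3685; arXiv:2012.03883 [CavalarKumarRossman2022].
* R. Alweiss, S. Lovett, K. Wu, J. Zhang, *Improved bounds for the sunflower lemma*,
  Ann. of Math. 194 (2021); arXiv:1908.08483.
* D. Harnik, R. Raz, *Higher lower bounds on monotone size*, STOC 2000.
-/

namespace Literature.Computability.Complexity

open Filter Finset

/-- `S_P = {P(1), …, P(k)} ⊆ 𝔽_n`, the set of values of `P ∈ 𝔽_n[x]` at `1, …, k`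
(possibly fewer than `k` elements). [Cavalar–Kumar–Rossman, arXiv:2012.03883, §2.3] [cite: CavalarKumarRossman2022, §2.3] -/
noncomputable def harnikRazSet (n k : ℕ) (P : Polynomial (ZMod n)) : Finset (ZMod n) :=
  (Finset.range k).image fun i => P.eval ((i + 1 : ℕ) : ZMod n)

open Classical in
/-- The **Harnik–Raz function** `f_HR^{(c,k)}` on variables indexed by `𝔽_n = ZMod n`:
`f_HR(x) = ⋁_{S ∈ 𝒮} ⋀_{j ∈ S} x_j` over the family
`𝒮 = {S_P : P ∈ 𝔽_n[x], deg P ≤ c - 1, |S_P| ≥ k/2}` (`|S_P| ≥ k/2` rendered as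
`k ≤ 2 |S_P|`). [Cavalar–Kumar–Rossman, arXiv:2012.03883, §2.3 "The function"; Harnik–Raz 2000] [cite: CavalarKumarRossman2022, §2.3] -/
noncomputable def harnikRazFn (n c k : ℕ) (x : ZMod n → Bool) : Bool :=
  decide (∃ P : Polynomial (ZMod n), P.natDegree + 1 ≤ c ∧ k ≤ 2 * (harnikRazSet n k P).card ∧
    ∀ j ∈ harnikRazSet n k P, x j = true)

/-- Unfolding `harnikRazFn`. [folklore] -/
theorem harnikRazFn_eq_true_iff {n c k : ℕ} {x : ZMod n → Bool} :
    harnikRazFn n c k x = true ↔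
      ∃ P : Polynomial (ZMod n), P.natDegree + 1 ≤ c ∧ k ≤ 2 * (harnikRazSet n k P).card ∧
        ∀ j ∈ harnikRazSet n k P, x j = true := by
  classical
  simp [harnikRazFn]

/-- The Harnik–Raz function is monotone (it is an OR of ANDs of variables).
[Cavalar–Kumar–Rossman, arXiv:2012.03883, §2.3] [folklore] -/
theorem harnikRazFn_monotone (n c k : ℕ) : Monotone (harnikRazFn n c k) := by
  intro x y hxy
  rcases hx : harnikRazFn n c k x with _ | _
  · exact Bool.false_le _
  · obtain ⟨P, hP, hk, hS⟩ := harnikRazFn_eq_true_iff.1 hx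
    rw [harnikRazFn_eq_true_iff.2 ⟨P, hP, hk, fun j hj => ?_⟩]
    have := hxy j
    rw [hS j hj] at this
    exact top_le_iff.1 this

/-- **Cavalar–Kumar–Rossman** (arXiv:2012.03883v2, Thm. 2.19 = `thm:hr_lower_bound`, §2.7; from
the Alweiss–Lovett–Wu–Zhang robust-sunflower bound). There are a constant `T > 0` (the paper's
`18 B`) and `ε > 0` such that for all sufficiently large primes `n`, with `k = ⌊√n⌋` and
`c = ⌊√n⌋ / (T ⌊log₂ n⌋)`, every fan-in-2 monotone circuit computing the Harnik–Raz function
`f_HR^{(c,k)}` on the `n` variables indexed by `𝔽_n` has at least `2^{ε √n / log n}` gates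
(`= 2^{Ω(c)}`; i.e. `exp (n^{1/2 - o(1)})`). [cite: CavalarKumarRossman2022, Thm. 2.19] -/
def cavalar_kumar_rossman : Prop :=
  ∃ T : ℕ, 0 < T ∧ ∃ ε : ℝ, 0 < ε ∧ ∀ᶠ n : ℕ in atTop, n.Prime →
    ∀ C : Circuit (ZMod n), C.IsOver monotoneBasis →
      C.Computes (harnikRazFn n (Nat.sqrt n / (T * Nat.log 2 n)) (Nat.sqrt n)) →
        (2 : ℝ) ^ (ε * Real.sqrt n / Real.log n) ≤ (C.size : ℝ)

end Literature.Computability.Complexity
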